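import Mathlib
import Literature.Analysis.OperatorTheory.ContractiveDetComplexity
import Literature.Analysis.OperatorTheory.ContractiveDeterminantalRepresentations
import Summits.ValiantsHypothesis.ValiantsHypothesis.Theorems.ContractivityPricePriceOfContractivityStubOneLargeClass
import HarnessLib

/-!
# ♦ for few colour classes — piece (W5) `piece3_assembly`: assembly of the realisation

Crux `PriceOfContractivity` (stmt-ValiantsHypothesis-10583), line `registered` (birth rev 10),
registered partial case `stub_stableLifting_fewColours` (Theorem A″, few colour classes), piece
`piece3_assembly` (W5) of its mini-skeleton.

Given a colour `x`, an abstract forest on a finite vertex type `V` (parent map `par`, rank `rk`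
with `rk root = 1`, `rk child = rk parent + 1`, colours `col : V → σ`, monomials `mon` with
`mon root = X_{col root}`, `mon child = mon parent · X_{col child}`), a scale `r > 0`, a weight
`τ ≥ 1` and univariate polynomials `a, E_w` (`w : V`) of degree `≤ N + 1` with `a₀ = 1`,
`|a_{j+1}| ≤ Ma r^j`, `|E_{w,j}| ≤ Me r^j`, we build the explicit matrix
`K₁ = [[A′, B′], [C′, D′]]` on `Fin (N+1) ⊕ V`, coloured `(x, …, x; col)`:
* `A′ = -r Sᵀ`, `S` the companion ("backward shift") matrix of the RESCALED coefficient sequence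
  `â_j = a_j / r^j`, so that `1 + ξ A′ = (1 - (rξ) S)ᵀ` and `det (1 + ξA′) = a(ξ)`
  (landed `OneLargeClass.det_one_sub_smul_shiftMat`);
* `B′ = e₀ ⊗ (τ · 1_roots)ᵀ`;
* `C′_w = -r · (Ê_{w,k+1} - Ê_{w,0} â_{k+1})_k` (rescaled shifted coefficient rows);
* `D′ = -τ N₀ + τ Ê(0) · 1_rootsᵀ`, `N₀[v,w] = 1` iff `v = par w` (the `τ`-weighted forest).
Pointwise, for `a(ξ) ≠ 0`, the Schur complement of `1 + ξA′` in the pencil is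
`1 + Y · τ (-N₀ + ẽ(ξ) 1_rootsᵀ) = 1 + (τY) · (-N₀ + ẽ(ξ) 1_rootsᵀ)`, `ẽ_v(ξ) = E_v(ξ)/a(ξ)`
(shift realisation formula, landed `OneLargeClass.shift_identity`), whose determinant is
`1 + Σ_w ẽ_w(ξ) τ^{rk w} mon_w` by the forest determinant identity (the FIRST HYPOTHESIS of the
theorem, = the registered neighbour piece W4, applied with `y_w = τ z_{col w}` and monomials
`τ^{rk w} mon_w`); the polynomial identity follows on multiplying by `â ≠ 0` in the domain
`ℂ[X_σ]` (landed `OneLargeClass.schur_eq_of_eval_eq`).  Entry bounds are read off: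
`|A′| ≤ max (r, Ma)`, `|B′| ≤ τ`, `|C′| ≤ Me (r + Ma)`, `|D′| ≤ τ (1 + Me)`.
This is the landed `OneLargeClass.piece_d_assembly` with its 3-node trie replaced by an abstract
forest; all folklore linear algebra.
-/

noncomputable section

-- `Summit.<Summit>.<Problem>` repeats `ValiantsHypothesis` by the tree's layout convention (D-0017).
set_option linter.dupNamespace false

namespace Summit.ValiantsHypothesis.ValiantsHypothesis.Theorems.PriceOfContractivity.FewColours

open Matrix
open Literature.Analysis.OperatorTheory (eval_det_one_add_diagonal_mul_map_C)
open Summit.ValiantsHypothesis.ValiantsHypothesis.Theorems.PriceOfContractivity.OneLargeClass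
  (sum_rescaled_coeff one_add_smul_blkA det_one_sub_smul_shiftMat shift_identity
    schur_one_add_diagonal_mul_fromBlocks schur_det_blocks_pointwise schur_eq_of_eval_eq
    schur_eval_aeval_X)

/-! ### The blocks (introduced through hypotheses on their entries; no auxiliary definitions)

Throughout this section: `S` is the companion ("backward shift") matrix of the coefficient
sequence `b` (column `0` is `-(b₁, …, b_{N+1})`, `S_{k-1,k} = 1`), `A′ = -r Sᵀ`,
`B′ = e₀ ⊗ ρᵀ` for a weight vector `ρ : V → ℂ` (in the application: `τ` on the roots, `0`
elsewhere), and `C′_v = -r · (e_{v,k+1} - e_{v,0} b_{k+1})_k`. -/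

section Blocks

variable {N : ℕ} {V : Type} [Fintype V] [DecidableEq V] (rc : ℂ) (b : ℕ → ℂ) (e : V → ℕ → ℂ)
  (ρ : V → ℂ) (S : Matrix (Fin (N + 1)) (Fin (N + 1)) ℂ) (B' : Matrix (Fin (N + 1)) V ℂ)
  (C' : Matrix V (Fin (N + 1)) ℂ)
  (hS : ∀ i j : Fin (N + 1), S i j =
    if (j : ℕ) = 0 then -b ((i : ℕ) + 1) else if (i : ℕ) + 1 = (j : ℕ) then (1 : ℂ) else 0)
  (hB : ∀ (i : Fin (N + 1)) (w : V), B' i w = if (i : ℕ) = 0 then ρ w else 0)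
  (hC : ∀ (v : V) (k : Fin (N + 1)), C' v k =
    -(rc * (e v ((k : ℕ) + 1) - e v 0 * b ((k : ℕ) + 1))))

omit [Fintype V] [DecidableEq V] in
include hB hC in
/-- Entries of `C′ (1 + ξA′)⁻¹ B′`: column `w` carries the weight `ρ w`, and the entry is
`ρ_w · (-r ((1 - (rξ)S)⁻¹ ẽ_v)₀)`. [folklore; adapted from `OneLargeClass.blkC_inv_blkB_apply`] -/
theorem blkC_inv_blkB_apply (ξ : ℂ) (v w : V) :
    (C' * (1 + ξ • (-(rc • Sᵀ)))⁻¹ * B') v w =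
      ρ w * -(rc * (((1 - (rc * ξ) • S)⁻¹ *ᵥ
        (fun k : Fin (N + 1) => e v ((k : ℕ) + 1) - e v 0 * b ((k : ℕ) + 1))) 0)) := by
  rw [one_add_smul_blkA, ← Matrix.transpose_nonsing_inv, Matrix.mul_apply]
  have hB0 : ∀ i : Fin (N + 1), B' i w = if i = 0 then ρ w else 0 := by
    intro i
    have hi : ((i : ℕ) = 0) ↔ i = 0 := by rw [Fin.ext_iff, Fin.val_zero]
    simp only [hB, hi]
  simp only [hB0, mul_ite, mul_zero, Finset.sum_ite_eq', Finset.mem_univ, if_true]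
  rw [Matrix.mul_apply, Matrix.mulVec, dotProduct, mul_comm, Finset.mul_sum, Finset.mul_sum,
    ← Finset.sum_neg_distrib, Finset.mul_sum]
  refine Finset.sum_congr rfl fun k _ => ?_
  simp only [hC, Matrix.transpose_apply]
  ring

include hS hB hC in
/-- **Pointwise Schur complement of the assembled pencil.**  With `b₀ = 1` and
`β := Σ b_j (rξ)^j ≠ 0`:
`det [[1 + ξA′, ξB′], [Y C′, 1 + Y D′]] = β · det (1 + Y · (N₀ + (ε/β) ρᵀ))`,
`ε_v := Σ_k e_{v,k} (rξ)^k`, for `D′ = N₀ + e_{·,0} ρᵀ` and ANY matrix `N₀`. [folklore; the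
landed `OneLargeClass.det_pencil_blocks_pointwise` with the trie replaced by `N₀`, `ρ`] -/
theorem det_pencil_blocks_pointwise (ξ : ℂ) (hb0 : b 0 = 1)
    (hβ : ∑ j ∈ Finset.range (N + 2), b j * (rc * ξ) ^ j ≠ 0) (y : V → ℂ) (N₀ : Matrix V V ℂ) :
    (Matrix.fromBlocks (1 + ξ • (-(rc • Sᵀ))) (ξ • B') (Matrix.diagonal y * C')
        (1 + Matrix.diagonal y * (Matrix.of fun v w : V => N₀ v w + e v 0 * ρ w))).det =
      (∑ j ∈ Finset.range (N + 2), b j * (rc * ξ) ^ j) *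
        (1 + Matrix.diagonal y * (Matrix.of fun v w : V => N₀ v w +
          (∑ k ∈ Finset.range (N + 2), e v k * (rc * ξ) ^ k) /
            (∑ j ∈ Finset.range (N + 2), b j * (rc * ξ) ^ j) * ρ w)).det := by
  have hP : (1 + ξ • (-(rc • Sᵀ))).det = ∑ j ∈ Finset.range (N + 2), b j * (rc * ξ) ^ j := by
    rw [one_add_smul_blkA, Matrix.det_transpose]
    exact det_one_sub_smul_shiftMat S b hS hb0 (rc * ξ)
  have hPne : (1 + ξ • (-(rc • Sᵀ))).det ≠ 0 := by rw [hP]; exact hβ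
  have hM : (Matrix.of fun v w : V => N₀ v w + e v 0 * ρ w) -
      ξ • (C' * (1 + ξ • (-(rc • Sᵀ)))⁻¹ * B') =
      Matrix.of fun v w : V => N₀ v w +
        (∑ k ∈ Finset.range (N + 2), e v k * (rc * ξ) ^ k) /
          (∑ j ∈ Finset.range (N + 2), b j * (rc * ξ) ^ j) * ρ w := by
    ext v w
    have hsh := shift_identity S b hS hb0 (rc * ξ) hβ (e v)
    have hZ := blkC_inv_blkB_apply rc b e ρ S B' C' hB hC ξ v w
    simp only [Matrix.sub_apply, Matrix.smul_apply, smul_eq_mul, Matrix.of_apply, hZ]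
    linear_combination (-(ρ w)) * hsh
  rw [schur_det_blocks_pointwise ξ y _ B' C' _ hPne, hP, hM]

end Blocks

/-- **Piece (W5): assembly of the realisation for a forest of coefficient functions.**
Hypothesis: the forest determinant identity (registered piece W4) verbatim.  Given a colour `x`,
a ranked forest `(par, rk, col, mon)` on `V`, a scale `r > 0`, a weight `τ ≥ 1` and polynomials
`a, E_w` of degree `≤ N+1` with `a₀ = 1`, `|a_{j+1}| ≤ Ma r^j`, `|E_{w,j}| ≤ Me r^j`, there is an
explicit `K₁` on `Fin (N+1) ⊕ V` (blocks: `-r Sᵀ` for the rescaled companion matrix of `a`;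
`e₀ ⊗ τ 1_rootsᵀ`; the rescaled shifted coefficient rows of the `E_w`; the `τ`-weighted forest
`-τ N₀ + τ Ê(0) 1_rootsᵀ`) coloured `(x, …, x; col)`, with all entries of modulus
`≤ r + Ma + τ (1 + Me) + Me (r + Ma)` and pencil determinant `â + Σ_w Ê_w · τ^{rk w} mon_w`
(`^` = substitution `ξ ↦ X_x`). [folklore; generalizes `OneLargeClass.piece_d_assembly`] -/
theorem piece3_assembly :
    (∀ {A : Type} [CommRing A] {V : Type} [Fintype V] [DecidableEq V] (par : V → Option V) (rk : V → ℕ),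
      (∀ v w, par w = some v → rk v < rk w) →
      ∀ (y e mon : V → A), (∀ w, par w = none → mon w = y w) →
        (∀ v w, par w = some v → mon w = mon v * y w) →
        (1 + Matrix.diagonal y *
            Matrix.of (fun v w : V => (if par w = some v then (-1 : A) else 0) +
              e v * (if par w = none then 1 else 0))).det =
          1 + ∑ w, e w * mon w) →
    ∀ {σ : Type} (x : σ) {V : Type} [Fintype V] [DecidableEq V] (par : V → Option V) (rk : V → ℕ)
      (col : V → σ) (mon : V → MvPolynomial σ ℂ),
      (∀ w, par w = none → rk w = 1) → (∀ v w, par w = some v → rk w = rk v + 1) →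
      (∀ w, par w = none → mon w = MvPolynomial.X (col w)) →
      (∀ v w, par w = some v → mon w = mon v * MvPolynomial.X (col w)) →
      ∀ (N : ℕ) (r τ Ma Me : ℝ) (a : Polynomial ℂ) (E : V → Polynomial ℂ),
        0 < r → 1 ≤ τ → 0 ≤ Ma → 0 ≤ Me → a.coeff 0 = 1 → a.natDegree ≤ N + 1 →
        (∀ w, (E w).natDegree ≤ N + 1) →
        (∀ j : ℕ, ‖a.coeff (j + 1)‖ ≤ Ma * r ^ j) →
        (∀ (w : V) (j : ℕ), ‖(E w).coeff j‖ ≤ Me * r ^ j) →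
        ∃ K₁ : Matrix (Fin (N + 1) ⊕ V) (Fin (N + 1) ⊕ V) ℂ,
          (∀ i j, ‖K₁ i j‖ ≤ r + Ma + τ * (1 + Me) + Me * (r + Ma)) ∧
          (1 + Matrix.diagonal (fun i => MvPolynomial.X (Sum.elim (fun _ => x) col i)) *
              K₁.map (fun a : ℂ => (MvPolynomial.C a : MvPolynomial σ ℂ))).det =
            Polynomial.aeval (MvPolynomial.X x : MvPolynomial σ ℂ) a +
              ∑ w, Polynomial.aeval (MvPolynomial.X x : MvPolynomial σ ℂ) (E w) *
                (MvPolynomial.C ((τ : ℂ) ^ rk w) * mon w) := by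
  intro htrie σ x V _ _ par rk col mon hrk1 hrkS hmon1 hmonS N r τ Ma Me a E hr hτ hMa hMe ha0
    hadeg hEdeg hac hEc
  -- the data
  set rc : ℂ := (r : ℂ) with hrc
  set τc : ℂ := (τ : ℂ) with hτc
  have hrc0 : rc ≠ 0 := by rw [hrc]; exact_mod_cast hr.ne'
  have hnrc : ‖rc‖ = r := by rw [hrc, Complex.norm_real, Real.norm_eq_abs, abs_of_pos hr]
  have hτ0 : 0 < τ := lt_of_lt_of_le one_pos hτ
  have hnτc : ‖τc‖ = τ := by rw [hτc, Complex.norm_real, Real.norm_eq_abs, abs_of_pos hτ0]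
  set â : ℕ → ℂ := fun j => a.coeff j / rc ^ j with hâ
  set Ê : V → ℕ → ℂ := fun v j => (E v).coeff j / rc ^ j with hÊ
  set ρ : V → ℂ := fun w => if par w = none then τc else 0 with hρ
  set N₀ : Matrix V V ℂ := Matrix.of (fun v w : V => if par w = some v then -τc else 0) with hN₀
  set S : Matrix (Fin (N + 1)) (Fin (N + 1)) ℂ := Matrix.of (fun i j : Fin (N + 1) =>
    if (j : ℕ) = 0 then -â ((i : ℕ) + 1) else if (i : ℕ) + 1 = (j : ℕ) then (1 : ℂ) else 0) with hSdef
  set B' : Matrix (Fin (N + 1)) V ℂ := Matrix.of (fun (i : Fin (N + 1)) (w : V) =>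
    if (i : ℕ) = 0 then ρ w else 0) with hB'def
  set C' : Matrix V (Fin (N + 1)) ℂ := Matrix.of (fun (v : V) (k : Fin (N + 1)) =>
    -(rc * (Ê v ((k : ℕ) + 1) - Ê v 0 * â ((k : ℕ) + 1)))) with hC'def
  have hS : ∀ i j : Fin (N + 1), S i j =
      if (j : ℕ) = 0 then -â ((i : ℕ) + 1) else if (i : ℕ) + 1 = (j : ℕ) then (1 : ℂ) else 0 :=
    fun i j => rfl
  have hB : ∀ (i : Fin (N + 1)) (w : V), B' i w = if (i : ℕ) = 0 then ρ w else 0 := fun i w => rfl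
  have hC : ∀ (v : V) (k : Fin (N + 1)), C' v k =
      -(rc * (Ê v ((k : ℕ) + 1) - Ê v 0 * â ((k : ℕ) + 1))) := fun v k => rfl
  set Kb : Matrix (Fin (N + 1) ⊕ V) (Fin (N + 1) ⊕ V) ℂ :=
    Matrix.fromBlocks (-(rc • Sᵀ)) B' C' (Matrix.of fun v w : V => N₀ v w + Ê v 0 * ρ w) with hKb
  -- scalar bounds
  have hρle : ∀ w, ‖ρ w‖ ≤ τ := by
    intro w
    simp only [hρ]
    split_ifs
    · rw [hnτc]
    · rw [norm_zero]; exact hτ0.le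
  have hN₀le : ∀ v w, ‖N₀ v w‖ ≤ τ := by
    intro v w
    simp only [hN₀, Matrix.of_apply]
    split_ifs
    · rw [norm_neg, hnτc]
    · rw [norm_zero]; exact hτ0.le
  have hÊle : ∀ v j, ‖Ê v j‖ ≤ Me := by
    intro v j
    simp only [hÊ, norm_div, norm_pow, hnrc]
    rw [div_le_iff₀ (pow_pos hr _)]
    exact hEc v j
  have hâle : ∀ j, ‖â (j + 1)‖ ≤ Ma / r := by
    intro j
    simp only [hâ, norm_div, norm_pow, hnrc]
    rw [div_le_div_iff₀ (pow_pos hr _) hr, pow_succ]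
    calc ‖a.coeff (j + 1)‖ * r ≤ Ma * r ^ j * r := by gcongr; exact hac j
      _ = Ma * (r ^ j * r) := by ring
  have hp1 : 0 ≤ τ * (1 + Me) := mul_nonneg hτ0.le (by linarith)
  have hp2 : 0 ≤ Me * (r + Ma) := mul_nonneg hMe (by linarith)
  have hτle : τ ≤ τ * (1 + Me) := le_mul_of_one_le_right hτ0.le (by linarith)
  refine ⟨Kb, ?_, ?_⟩
  · -- entry bounds
    rintro (i | v) (j | w)
    · -- `A′` block: `|r â_{j+1}| ≤ Ma`, `|r| = r`
      rw [hKb, Matrix.fromBlocks_apply₁₁, Matrix.neg_apply, Matrix.smul_apply,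
        Matrix.transpose_apply, hS]
      simp only [smul_eq_mul, norm_neg, norm_mul, hnrc]
      split_ifs
      · rw [norm_neg]
        calc r * ‖â ((j : ℕ) + 1)‖ ≤ r * (Ma / r) := by gcongr; exact hâle _
          _ = Ma := mul_div_cancel₀ _ hr.ne'
          _ ≤ _ := by linarith
      · rw [norm_one, mul_one]; linarith
      · rw [norm_zero, mul_zero]; linarith
    · -- `B′` block
      rw [hKb, Matrix.fromBlocks_apply₁₂, hB]
      split_ifs
      · linarith [hρle w]
      · rw [norm_zero]; linarith
    · -- `C′` block: `|Ê_{v,k+1}|, |Ê_{v,0}| ≤ Me`, `|â_{k+1}| ≤ Ma / r`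
      rw [hKb, Matrix.fromBlocks_apply₂₁, hC, norm_neg, norm_mul, hnrc]
      have hk : ‖Ê v ((j : ℕ) + 1) - Ê v 0 * â ((j : ℕ) + 1)‖ ≤ Me + Me * (Ma / r) :=
        norm_sub_le_of_le (hÊle v _)
          ((norm_mul_le _ _).trans (mul_le_mul (hÊle v 0) (hâle _) (norm_nonneg _) hMe))
      calc r * ‖Ê v ((j : ℕ) + 1) - Ê v 0 * â ((j : ℕ) + 1)‖ ≤ r * (Me + Me * (Ma / r)) := by
            gcongr
        _ = r * Me + Me * (r * (Ma / r)) := by ring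
        _ = Me * (r + Ma) := by rw [mul_div_cancel₀ _ hr.ne']; ring
        _ ≤ _ := by linarith
    · -- `D′` block
      rw [hKb, Matrix.fromBlocks_apply₂₂, Matrix.of_apply]
      calc ‖N₀ v w + Ê v 0 * ρ w‖ ≤ ‖N₀ v w‖ + ‖Ê v 0‖ * ‖ρ w‖ :=
            norm_add_le_of_le le_rfl (norm_mul_le _ _)
        _ ≤ τ + Me * τ := by gcongr; exacts [hN₀le v w, hÊle v 0, hρle w]
        _ = τ * (1 + Me) := by ring
        _ ≤ _ := by linarith
  · -- the pencil identity: pointwise off the zero set of `a`, then `schur_eq_of_eval_eq`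
    have ha_ev0 : a.eval 0 ≠ 0 := by
      rw [← Polynomial.coeff_zero_eq_eval_zero, ha0]; exact one_ne_zero
    refine schur_eq_of_eval_eq x a ha_ev0 fun z hz => ?_
    have hâ0 : â 0 = 1 := by simp [hâ, ha0]
    have hβ : ∑ j ∈ Finset.range (N + 2), â j * (rc * z x) ^ j = a.eval (z x) :=
      sum_rescaled_coeff a hadeg hrc0 (z x)
    have hε : ∀ v : V, ∑ k ∈ Finset.range (N + 2), Ê v k * (rc * z x) ^ k = (E v).eval (z x) :=
      fun v => sum_rescaled_coeff (E v) (hEdeg v) hrc0 (z x)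
    have hβ0 : ∑ j ∈ Finset.range (N + 2), â j * (rc * z x) ^ j ≠ 0 := by rwa [hβ]
    have hdiag : (fun i : Fin (N + 1) ⊕ V => z (Sum.elim (fun _ => x) col i)) =
        Sum.elim (fun _ => z x) (fun w => z (col w)) := by
      funext i; rcases i with i | w <;> rfl
    rw [eval_det_one_add_diagonal_mul_map_C, hdiag, hKb, schur_one_add_diagonal_mul_fromBlocks,
      det_pencil_blocks_pointwise rc â Ê ρ S B' C' hS hB hC (z x) hâ0 hβ0 _ N₀, hβ]
    simp only [hε]
    -- the `τ`-rescaling of the forest matrix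
    have hresc : Matrix.diagonal (fun w => z (col w)) *
        (Matrix.of fun v w : V => N₀ v w + (E v).eval (z x) / a.eval (z x) * ρ w) =
        Matrix.diagonal (fun w => τc * z (col w)) *
          Matrix.of (fun v w : V => (if par w = some v then (-1 : ℂ) else 0) +
            (E v).eval (z x) / a.eval (z x) * (if par w = none then 1 else 0)) := by
      ext v w
      simp only [Matrix.diagonal_mul, Matrix.of_apply, hN₀, hρ]
      split_ifs <;> ring
    -- the forest identity (hypothesis W4) with weights `τ z_{col w}` and monomials `τ^{rk} mon`
    have hrklt : ∀ v w, par w = some v → rk v < rk w := fun v w h => by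
      rw [hrkS v w h]; exact Nat.lt_succ_self _
    have hroot : ∀ w, par w = none →
        τc ^ rk w * MvPolynomial.eval z (mon w) = τc * z (col w) := fun w hw => by
      rw [hrk1 w hw, hmon1 w hw, pow_one, MvPolynomial.eval_X]
    have hchild : ∀ v w, par w = some v → τc ^ rk w * MvPolynomial.eval z (mon w) =
        τc ^ rk v * MvPolynomial.eval z (mon v) * (τc * z (col w)) := fun v w h => by
      rw [hrkS v w h, hmonS v w h, pow_succ, map_mul, MvPolynomial.eval_X]; ring
    have hforest : (1 + Matrix.diagonal (fun w => τc * z (col w)) *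
          Matrix.of (fun v w : V => (if par w = some v then (-1 : ℂ) else 0) +
            (E v).eval (z x) / a.eval (z x) * (if par w = none then 1 else 0))).det =
        1 + ∑ w, (E w).eval (z x) / a.eval (z x) * (τc ^ rk w * MvPolynomial.eval z (mon w)) :=
      htrie par rk hrklt (fun w => τc * z (col w)) (fun v => (E v).eval (z x) / a.eval (z x))
        (fun w => τc ^ rk w * MvPolynomial.eval z (mon w)) hroot hchild
    rw [hresc, hforest]
    simp only [map_add, map_sum, map_mul, schur_eval_aeval_X, MvPolynomial.eval_C]
    rw [mul_add, mul_one, Finset.mul_sum]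
    congr 1
    refine Finset.sum_congr rfl fun w _ => ?_
    rw [← mul_assoc, mul_div_cancel₀ _ hz]

end Summit.ValiantsHypothesis.ValiantsHypothesis.Theorems.PriceOfContractivity.FewColours
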